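import Mathlib
import HarnessLib
import Summits.HubbardSuperconductivity.HubbardSuperconductivity.Theorems.KLProgrammeKLRegimeEngineTowerLevReadoutFitFBornSharp
import Summits.HubbardSuperconductivity.HubbardSuperconductivity.Theorems.KLProgrammeKLRegimeEngineTowerLevLawOfRowsF
import Summits.HubbardSuperconductivity.HubbardSuperconductivity.Theorems.KLProgrammeKLRegimeKernelNormsLevelsDegreeCap

/-!
# Route `KLProgramme` — crux K3 ENGINE (stmt-HubbardSuperconductivity-20437 `KLRegimeEngineV17F2`), stub (b) v2, THE LEVELS PACKAGE (ℓ), located item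
# «(ℓ)-READOUT-F», (R332)(D)(α′) second half «M6's BASE DATUM AT `d − 1` FROM THE LEVEL-0 DATUM»: `𝒱_j` READ AT ANY FAMILY `F_{J′}`, `1 ≤ J′ ≤ j`, IN THE
# LAW's PROFILE SHAPE, and the tower's BASE ROWS (`𝒱_d` at `F_{d−1}`) from the level-`0` datum and the block-`0` step (cell gate-hubbard-kl, seat
# gate-hubbard-kl-p3 g22; twin of this seat's `readoutLevF_le_levelsRHS_blockZero_sharp` (…TowerBlockZeroReadoutF) with the read-out family decoupled from the
# cutoff and the conclusion kept in floor units)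

WHY.  The re-based floor-keyed tower on `K_n` starts at `𝒱_d` and takes its BASE DATUM — `N_b t p ≥` every level-`(t+1)` norm of `𝒱_d = klTowerInput … d 1` at
`F_{d−1}`, with the unit law `N_b t p / klLevUnitF … t p (d−1) ≤ A_b′·λ^{p−1}·Q_b^p` (`p ≥ 3`) — from p3's weighted grid step at `(Λ_d, F_{d−1})`
(…TowerLevBaseFWgrid), i.e. modulo the weighted overlap rows of `E(F_{d−1}[K_n])·S_{4M}`, the same located class as the `j < d` grid rows (p3 g21, STATUS l.10537).
(α′) reads it instead from the LEVEL-`0` datum: `𝒱_d = 𝒱_1 + (𝒱_d − 𝒱_1)` at the family `F_{d−1}`, the base `𝒱_1 @ F_0` jumped to `F_{d−1}` (`floorJump_readout_le`,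
`0 + 1 ≤ d − 1`) and the thick-block increment born at `F_1` by the block-`0` kit step (…TowerPartialIncrLevStepFOne at `(1,1)`, slice `(Λ_d, Λ_1]`) and jumped
to `F_{d−1}` (or read at `F_1` itself when `d = 2`).  §1 is the generic engine: the read-out of `𝒱_j` at ANY family `F_{J′}` with `1 ≤ J′ ≤ j` (at `J′ = j` it is
the first five steps of `readoutLevF_le_levelsRHS_blockZero_sharp`), at an arbitrary scale parameter `λ > 0`, concluded in floor units
`‖𝒱_j‖_{Ωe}/klLevUnitF … t p J′ ≤ A_tot·λ^{p−1}·Q_tot^p` (`3 ≤ p ≤ D`, every track); §2 packages the base rows at `(j, J′) := (d, d−1)` with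
`N_b t p := klTowerMeasLev … d 1 (2p) (t+1)` (the honest supremum; degrees `p > D` vanish by nilpotency under the field cap).

* §1 **`readoutLevF_le_profile_blockZero_sharp`** — `∃ C_inc ≥ 1, D_inc ≥ 1` and thresholds: for every `FrameOK` frame, `1 ≤ J′ ≤ j`, `J′ ≤ n_β + 1`, `D ≥ 3`,
  `λ > 0`, the level-`0` rows (`N_b` at `F_0`, unit law at `J = 0`, Chernoff/import rows of `klTowerMuLevF … 1 1` at `λ`), the five smallness rows, the born step of
  `𝒱_j − 𝒱_1` at `F_1` in kit form, `A_ro = C_inc·A_b`, `Q_ro = D_inc·Q_b`, `Q_tot`, sharp `A_tot`: for `3 ≤ p ≤ D` and every `Ωe` of level `t + 1` at `F_{J′}`,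
  `klLevNormOf … J′ (2p) 𝒱_j Ωe / klLevUnitF … t p J′ ≤ A_tot·λ^{p−1}·Q_tot^p`;
* §2 `klTowerMeasLev_one_baseRows` — `N_b := klTowerMeasLev … d 1` is nonnegative and dominates (`hcar`, every `d`);
  **`baseLawF_blockZero_sharp`** — for `2 ≤ d`, `d − 1 ≤ n_β + 1`, the field cap `card ≤ 2D + 1` and §1's rows at `(d, d−1)`:
  `klTowerMeasLev … d 1 (2p) (t+1) / klLevUnitF … t p (d−1) ≤ A_tot·λ^{p−1}·Q_tot^p` for EVERY `p ≥ 3` — the `hlawb` row of `klTowerBLevF_le_law_lev_of_doors_of_le_B` /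
  `readoutLevF_le_levelsRHS_of_bornRows(_sharp)` with `(A_b′, Q_b) := (A_tot, Q_tot)`.
Compositions of landed theorems and real algebra; nothing about the model is asserted beyond them; nothing asserts (ℓ), any stub, K3 or superconductivity.
References: BGM 2006 §2.8 (2.82)–(2.84), (2.93)–(2.98), Lemma 2.5 (2.98) [cite: BenfattoGiulianiMastropietro2006].
-/

noncomputable section

namespace Summit.HubbardSuperconductivity.HubbardSuperconductivity.Theorems.EngineV8

set_option linter.dupNamespace false -- summit = problem name (single-conjunct summit), D-0017

open Classical
open Real Finset Literature.MathematicalPhysics.QuantumLattice Literature.Probability.LatticeModels GrassmannAlgebra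
open Literature.MathematicalPhysics.QuantumLattice.FermiRG
open Summit.HubbardSuperconductivity.HubbardSuperconductivity.Theorems.KLProgrammeLegKernels
open Summit.HubbardSuperconductivity.HubbardSuperconductivity.Theorems.KLRegimeSplit
open Summit.HubbardSuperconductivity.HubbardSuperconductivity.Theorems.KLRegimeWick
open Summit.HubbardSuperconductivity.HubbardSuperconductivity.Theorems.TorusFourierL2
open Summit.HubbardSuperconductivity.HubbardSuperconductivity.Theorems.DispersionFlow
open Summit.HubbardSuperconductivity.HubbardSuperconductivity.Theorems.PerturbedFermiCurve

variable {L M : ℕ} [NeZero L] [NeZero M]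

/-! ## §1 The read-out of `𝒱_j` at any family `F_{J′}`, `1 ≤ J′ ≤ j`, in the law's profile shape -/

omit [NeZero L] [NeZero M] in
/-- **THE READ-OUT OF `𝒱_j` AT ANY FAMILY `F_{J′}`, `1 ≤ J′ ≤ j`, FROM THE LEVEL-`0` DATUM AND THE BLOCK-`0` STEP, IN FLOOR UNITS — SHARP ENVELOPE**
(see the module docstring; `λ > 0` arbitrary; `C_inc, D_inc ≥ 1`). [cite: BenfattoGiulianiMastropietro2006, §2.8 (2.82)-(2.84), (2.93)-(2.98), Lemma 2.5 (2.98)] -/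
theorem readoutLevF_le_profile_blockZero_sharp :
    ∃ Cinc Dinc : ℝ, 1 ≤ Cinc ∧ 1 ≤ Dinc ∧ ∀ R : RenConsts, R.WF2 → ∃ c₃' : ℝ, 0 < c₃' ∧ ∃ U₀' : ℝ, 0 < U₀' ∧
      ∀ (P : SplitConsts) (c : ℝ), P.WF → 0 < c → c ≤ klEngC₃6 P R → c ≤ c₃' →
      ∀ μ ∈ klWindowC, ∀ U : ℝ, 0 < U → U ≤ klEngU₀9 P R c → U ≤ U₀' → ∀ β : ℝ, klBetaMin ≤ β → β ≤ Real.exp (c / U ^ 2) →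
      ∀ K : TrigPolyC4v, FrameOK R U (nScales β) μ K → ∀ (L M : ℕ) [NeZero L] [NeZero M],
      klEngL₃ β U ≤ L → klEngM₃ β U L ≤ M → ∀ j J' D : ℕ, 1 ≤ J' → J' ≤ j → J' ≤ nScales β + 1 → 3 ≤ D →
      ∀ (lam Ab Qb : ℝ), 0 < lam → 0 ≤ Ab → 0 ≤ Qb →
      -- the level-`0` datum: `𝒱_1` at `F_0` and its unit law at `J = 0`, at `λ`
      ∀ Nb : Fin 5 → ℕ → ℝ, (∀ t p, 0 ≤ Nb t p) →
        (∀ (t : Fin 5) (p : ℕ) (Ωe' : Fin (2 * p) → Option (SectorLeg (sectorCount 0))), levelCount Ωe' = (t : ℕ) + 1 →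
          klLevNormOf L M β μ K 0 (2 * p) (klTowerInput L M β U μ K 1 1) Ωe' ≤ Nb t p) →
        (∀ (t : Fin 5) (p : ℕ), 3 ≤ p → Nb t p / klLevUnitF β M t p 0 ≤ Ab * lam ^ (p - 1) * Qb ^ p) →
      ∀ (W Z σ Φ ψ τ A' Q' ι₁ ι₂ ι₃ : ℝ), 0 < W → 0 < Z → 0 ≤ σ → 0 ≤ Φ → 0 ≤ ψ → 0 < τ → 0 ≤ A' → 0 < Q' →
      -- the Chernoff data of the level-`0` datum in floor units (`klTowerMuLevF … 1 1`) and the imports, at `λ`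
      (∀ m, 4 ≤ m → m ≤ D → W * Z ^ m * klTowerMuLevF L M β U μ K 1 1 m ≤ A' * lam ^ (m - 1) * Q' ^ m) →
      W * Z ^ 3 * klTowerMuLevF L M β U μ K 1 1 3 ≤ ι₃ * lam ^ 2 →
      W * Z ^ 1 * klTowerMuLevF L M β U μ K 1 1 1 ≤ ι₁ * lam →
      W * Z ^ 2 * klTowerMuLevF L M β U μ K 1 1 2 ≤ ι₂ * lam →
      -- the five smallness rows at `(A′, Q′, λ)`
      4 * σ * lam * Q' < 1 → 2 * lam * τ * Q' ≤ 1 → exp 1 * τ * lam * Q' < 1 →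
      Φ * (τ * (ι₁ * lam + ι₂ / (2 * Q') + ι₃ / (4 * Q' ^ 2) + A' * Q' / 4)) < 1 →
      Φ * (exp 1 * τ * (ι₁ * lam) + (exp 1 * τ) ^ 2 * (ι₂ * lam) + (exp 1 * τ) ^ 3 * (ι₃ * lam ^ 2) +
        A' * (exp 1 * τ * Q') * ((exp 1 * τ * lam * Q') ^ 3 / (1 - exp 1 * τ * lam * Q'))) < 1 →
      -- the block-`0` step BORN AT `F_1` (tail of `blockZeroIncrLevF_le_kitStep_klEng` / `partialIncrLevF_le_kitStep_of_bounds'` at `(1,1)`, verbatim shape)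
      (∀ N : ℕ, 1 ≤ N → Φ * towerV D τ (fun m => W * Z ^ m * klTowerMuLevF L M β U μ K 1 1 m) < 1 →
        ∀ (t : Fin 5) (q : ℕ) (Ωe : Fin (2 * q + 1 + 1) → Option (SectorLeg (sectorCount 1))), levelCount Ωe = (t : ℕ) + 1 →
        klLevNormOf L M β μ K 1 (2 * q + 1 + 1) (klEffectiveAction L M β U μ K klE0 j - klTowerInput L M β U μ K 1 1) Ωe /
            klLevUnitF β M t (q + 1) 1 ≤
          towerFO D σ (fun m => W * Z ^ m * klTowerMuLevF L M β U μ K 1 1 m) (q + 1) +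
            ∑ n' ∈ Icc 2 N, exp 1 * Φ ^ (n' - 1) * ψ ^ (q + 1) * towerS D τ (fun m => W * Z ^ m * klTowerMuLevF L M β U μ K 1 1 m) n' (q + 1) +
            ψ ^ (q + 1) * exp 1 * towerV D τ (fun m => W * Z ^ m * klTowerMuLevF L M β U μ K 1 1 m) *
              (Φ * towerV D τ (fun m => W * Z ^ m * klTowerMuLevF L M β U μ K 1 1 m)) ^ N /
              (1 - Φ * towerV D τ (fun m => W * Z ^ m * klTowerMuLevF L M β U μ K 1 1 m))) →
      -- the read-out constants (equational binders)
      ∀ (Aro Qro Qtot Atot : ℝ), Aro = Cinc * Ab → Qro = Dinc * Qb → Qtot = Dinc * max 1 (max Qro (max (4 * Q') (2 * τ * ψ * Q'))) →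
        Atot = Aro + Cinc * (A' * (4 * σ * lam * Q' / (1 - 4 * σ * lam * Q')) +
          exp 1 * (τ * (ι₁ * lam + ι₂ / (2 * Q') + ι₃ / (4 * Q' ^ 2) + A' * Q' / 4)) *
            (Φ * (τ * (ι₁ * lam + ι₂ / (2 * Q') + ι₃ / (4 * Q' ^ 2) + A' * Q' / 4)) /
              (1 - Φ * (τ * (ι₁ * lam + ι₂ / (2 * Q') + ι₃ / (4 * Q' ^ 2) + A' * Q' / 4)))) / (2 * τ * Q')) →
      ∀ (t : Fin 5) (p : ℕ), 3 ≤ p → p ≤ D →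
      ∀ Ωe : Fin (2 * p) → Option (SectorLeg (sectorCount J')), levelCount Ωe = (t : ℕ) + 1 →
        klLevNormOf L M β μ K J' (2 * p) (klEffectiveAction L M β U μ K klE0 j) Ωe / klLevUnitF β M t p J' ≤ Atot * lam ^ (p - 1) * Qtot ^ p := by
  obtain ⟨C₁', C₂', hC₁', hC₂', hJ⟩ := floorJump_readout_le
  refine ⟨max 1 ((27 : ℝ) ^ 5 * (C₁' / C₂')), max 1 (C₂' ^ 2), le_max_left _ _, le_max_left _ _, fun R hR2 => ?_⟩
  obtain ⟨c₃'', hc₃'', U₀'', hU₀'', hJ'⟩ := hJ R hR2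
  refine ⟨c₃'', hc₃'', U₀'', hU₀'', ?_⟩
  intro P c hP hc hc6 hcB μ hμ U hU hU9 hUB β hβmin hβc K hK L M _ _ hL3 hM3 j J' D hJ1 hJj hJN hD lam Ab Qb hlam hAb hQb Nb hNb0 hcar
    hlawb W Z σ Φ ψ τ A' Q' ι₁ ι₂ ι₃ hW hZ hσ hΦ hψ hτ hA'0 hQ'0 hprof hprof3 himp₁ himp₂ hx₁ hx₂ hx₃ hy hθ hborn Aro Qro Qtot Atot hAro hQro hQtot
    hAtot t p hp hpD Ωe hlev
  have hβ : 0 < β := KLRegimeSplit.pos_of_klBetaMin_le hβmin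
  have hu : 0 < klLevUnitF β M t p J' := klLevUnitF_pos hβ t p J'
  set μk : ℕ → ℝ := fun m => W * Z ^ m * klTowerMuLevF L M β U μ K 1 1 m with hμk
  have hμ0 : ∀ m, 0 ≤ μk m := fun m =>
    mul_nonneg (by positivity) (klTowerMuLevF_nonneg (L := L) (M := M) hβ U μ K 1 1 m)
  set Cinc : ℝ := max 1 ((27 : ℝ) ^ 5 * (C₁' / C₂')) with hCincdef
  set Dinc : ℝ := max 1 (C₂' ^ 2) with hDincdef
  have hCinc1 : 1 ≤ Cinc := le_max_left _ _
  have hCinc0 : 0 < Cinc := lt_of_lt_of_le one_pos hCinc1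
  have hCinc27 : (27 : ℝ) ^ 5 * (C₁' / C₂') ≤ Cinc := le_max_right _ _
  have hDinc1 : (1 : ℝ) ≤ Dinc := le_max_left _ _
  have hDinc0 : (0 : ℝ) < Dinc := lt_of_lt_of_le one_pos hDinc1
  have hDsq : C₂' ^ 2 ≤ Dinc := le_max_right _ _
  have ht := t.isLt
  -- the nonnegativity of the imports from the rows
  have hι₁0 : 0 ≤ ι₁ := by
    have h1 : 0 ≤ ι₁ * lam := (hμ0 1).trans himp₁
    rw [mul_comm] at h1
    exact nonneg_of_mul_nonneg_right h1 hlam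
  have hι₂0 : 0 ≤ ι₂ := by
    have h1 : 0 ≤ ι₂ * lam := (hμ0 2).trans himp₂
    rw [mul_comm] at h1
    exact nonneg_of_mul_nonneg_right h1 hlam
  have hι₃0 : 0 ≤ ι₃ := by
    have h1 : 0 ≤ ι₃ * lam ^ 2 := (hμ0 3).trans hprof3
    rw [mul_comm] at h1
    exact nonneg_of_mul_nonneg_right h1 (by positivity)
  have hAro0 : 0 ≤ Aro := by rw [hAro]; positivity
  have hQro0 : 0 ≤ Qro := by rw [hQro]; positivity
  -- (1) the re-measured part: the level-`0` datum `𝒱_1 @ F_0` jumped ONCE to `F_{J′}` (`0 + 1 ≤ J′`), weight `27^{t+1} ≤ 27^5`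
  have hbaseW : ∀ Ωe' : Fin (2 * p) → Option (SectorLeg (sectorCount 0)), levelCount Ωe' = (t : ℕ) + 1 →
      (27 : ℝ) ^ ((t : ℕ) + 1) * klLevNormOf L M β μ K 0 (2 * p) (klTowerInput L M β U μ K 1 1) Ωe' / klLevUnitF β M t p 0 ≤
        (27 : ℝ) ^ 5 * (Ab * lam ^ (p - 1) * Qb ^ p) := by
    intro Ωe' hlev'
    have hu0 : 0 < klLevUnitF β M t p 0 := klLevUnitF_pos hβ t p 0
    have h27 : (27 : ℝ) ^ ((t : ℕ) + 1) ≤ (27 : ℝ) ^ 5 := pow_le_pow_right₀ (by norm_num) (by omega)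
    have hq : klLevNormOf L M β μ K 0 (2 * p) (klTowerInput L M β U μ K 1 1) Ωe' / klLevUnitF β M t p 0 ≤ Ab * lam ^ (p - 1) * Qb ^ p :=
      (div_le_div_of_nonneg_right (hcar t p Ωe' hlev') hu0.le).trans (hlawb t p hp)
    rw [mul_div_assoc]
    exact mul_le_mul h27 hq (div_nonneg (klLevNormOf_nonneg hβ.le μ K 0 (2 * p) _ Ωe') hu0.le) (by positivity)
  have hro : klLevNormOf L M β μ K J' (2 * p) (klTowerInput L M β U μ K 1 1) Ωe / klLevUnitF β M t p J' ≤ Aro * lam ^ (p - 1) * Qro ^ p := by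
    have hjmp := hJ' P c hP hc hc6 hcB μ hμ U hU hU9 hUB β hβmin hβc K hK L M hL3 hM3 0 J' (by omega) hJN
      (klTowerInput L M β U μ K 1 1) (fun m' X hX => by
        unfold klTowerInput; exact klEffectiveAction_momentumConserving β U μ K klE0 (1 * 1) m' X hX) t p (by omega) hp _ (by positivity)
      hbaseW Ωe hlev
    refine hjmp.trans ?_
    rw [hAro, hQro]
    have hsq : (C₂' ^ 2) ^ p ≤ Dinc ^ p := pow_le_pow_left₀ (sq_nonneg _) hDsq _
    calc C₁' / C₂' * (C₂' ^ 2) ^ p * ((27 : ℝ) ^ 5 * (Ab * lam ^ (p - 1) * Qb ^ p))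
        = ((27 : ℝ) ^ 5 * (C₁' / C₂')) * (C₂' ^ 2) ^ p * (Ab * lam ^ (p - 1) * Qb ^ p) := by ring
      _ ≤ Cinc * Dinc ^ p * (Ab * lam ^ (p - 1) * Qb ^ p) :=
          mul_le_mul_of_nonneg_right (mul_le_mul hCinc27 hsq (by positivity) hCinc0.le) (by positivity)
      _ = Cinc * Ab * lam ^ (p - 1) * (Dinc * Qb) ^ p := by rw [mul_pow]; ring
  -- (2) `𝒱_j = 𝒱_1 + (𝒱_j − 𝒱_1)`: the public size is at most `ro + inc`
  have hpub : klLevNormOf L M β μ K J' (2 * p) (klEffectiveAction L M β U μ K klE0 j) Ωe / klLevUnitF β M t p J' ≤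
      klLevNormOf L M β μ K J' (2 * p) (klTowerInput L M β U μ K 1 1) Ωe / klLevUnitF β M t p J' +
        klLevNormOf L M β μ K J' (2 * p) (klEffectiveAction L M β U μ K klE0 j - klTowerInput L M β U μ K 1 1) Ωe / klLevUnitF β M t p J' := by
    rw [← add_div]
    refine div_le_div_of_nonneg_right ?_ hu.le
    have h := klLevNormOf_add_le hβ.le μ K J' (2 * p) (klTowerInput L M β U μ K 1 1)
      (klEffectiveAction L M β U μ K klE0 j - klTowerInput L M β U μ K 1 1) Ωe
    rwa [add_sub_cancel] at h
  -- (3) the increment at `F_{J′}` from the BORN step at `F_1`: jumped for `2 ≤ J′`; at `J′ = 1` read directly (zero when `j = 1`)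
  have hV0 : 0 ≤ towerV D τ μk := towerV_nonneg hτ.le hμ0
  have hkit0 : ∀ (N q : ℕ), Φ * towerV D τ μk < 1 →
      0 ≤ towerFO D σ μk q + ∑ n' ∈ Icc 2 N, exp 1 * Φ ^ (n' - 1) * ψ ^ q * towerS D τ μk n' q +
        ψ ^ q * exp 1 * towerV D τ μk * (Φ * towerV D τ μk) ^ N / (1 - Φ * towerV D τ μk) := by
    intro N q hg
    have h1 : 0 ≤ towerFO D σ μk q := towerFO_nonneg hσ hμ0 q
    have h2 : 0 ≤ ∑ n' ∈ Icc 2 N, exp 1 * Φ ^ (n' - 1) * ψ ^ q * towerS D τ μk n' q :=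
      sum_nonneg fun n' _ => by have := towerS_nonneg (D := D) hτ.le hμ0 n' q; positivity
    have h3 : 0 ≤ ψ ^ q * exp 1 * towerV D τ μk * (Φ * towerV D τ μk) ^ N / (1 - Φ * towerV D τ μk) :=
      div_nonneg (by positivity) (sub_nonneg.2 hg.le)
    linarith
  have hCD1 : (1 : ℝ) ≤ Cinc * Dinc ^ p := one_le_mul_of_one_le_of_one_le hCinc1 (one_le_pow₀ hDinc1)
  have hincj : ∀ N : ℕ, 2 ≤ N → Φ * towerV D τ μk < 1 →
      klLevNormOf L M β μ K J' (2 * p) (klEffectiveAction L M β U μ K klE0 j - klTowerInput L M β U μ K 1 1) Ωe / klLevUnitF β M t p J' ≤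
        Cinc * Dinc ^ p * (towerFO D σ μk p + ∑ n' ∈ Icc 2 N, exp 1 * Φ ^ (n' - 1) * ψ ^ p * towerS D τ μk n' p +
          ψ ^ p * exp 1 * towerV D τ μk * (Φ * towerV D τ μk) ^ N / (1 - Φ * towerV D τ μk)) := by
    intro N hN hg
    have hk0 := hkit0 N p hg
    obtain ⟨q, rfl⟩ : ∃ q, p = q + 1 := ⟨p - 1, by omega⟩
    by_cases hjk : 1 + 1 ≤ J'
    · -- the born bound at `F_1`, weighted, then jumped to `F_{J′}`
      have hbornW : ∀ Ωe' : Fin (2 * (q + 1)) → Option (SectorLeg (sectorCount 1)), levelCount Ωe' = (t : ℕ) + 1 →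
          (27 : ℝ) ^ ((t : ℕ) + 1) * klLevNormOf L M β μ K 1 (2 * (q + 1))
              (klEffectiveAction L M β U μ K klE0 j - klTowerInput L M β U μ K 1 1) Ωe' / klLevUnitF β M t (q + 1) 1 ≤
            (27 : ℝ) ^ ((t : ℕ) + 1) * (towerFO D σ μk (q + 1) + ∑ n' ∈ Icc 2 N, exp 1 * Φ ^ (n' - 1) * ψ ^ (q + 1) * towerS D τ μk n' (q + 1) +
              ψ ^ (q + 1) * exp 1 * towerV D τ μk * (Φ * towerV D τ μk) ^ N / (1 - Φ * towerV D τ μk)) := by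
        intro Ωe' hlev'
        rw [mul_div_assoc]
        exact mul_le_mul_of_nonneg_left (hborn N (by omega) hg t q Ωe' hlev') (by positivity)
      have hjmp := hJ' P c hP hc hc6 hcB μ hμ U hU hU9 hUB β hβmin hβc K hK L M hL3 hM3 1 J' hjk hJN
        (klEffectiveAction L M β U μ K klE0 j - klTowerInput L M β U μ K 1 1) (partialIncr_momentumConserving β U μ K 1 1 j) t (q + 1)
        (by omega) hp _ (by positivity) hbornW Ωe hlev
      refine hjmp.trans ?_
      have h27 : (27 : ℝ) ^ ((t : ℕ) + 1) ≤ (27 : ℝ) ^ 5 := pow_le_pow_right₀ (by norm_num) (by omega)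
      have hsq : (C₂' ^ 2) ^ (q + 1) ≤ Dinc ^ (q + 1) := pow_le_pow_left₀ (sq_nonneg _) hDsq _
      calc C₁' / C₂' * (C₂' ^ 2) ^ (q + 1) * ((27 : ℝ) ^ ((t : ℕ) + 1) *
              (towerFO D σ μk (q + 1) + ∑ n' ∈ Icc 2 N, exp 1 * Φ ^ (n' - 1) * ψ ^ (q + 1) * towerS D τ μk n' (q + 1) +
                ψ ^ (q + 1) * exp 1 * towerV D τ μk * (Φ * towerV D τ μk) ^ N / (1 - Φ * towerV D τ μk)))
          ≤ C₁' / C₂' * Dinc ^ (q + 1) * ((27 : ℝ) ^ 5 *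
              (towerFO D σ μk (q + 1) + ∑ n' ∈ Icc 2 N, exp 1 * Φ ^ (n' - 1) * ψ ^ (q + 1) * towerS D τ μk n' (q + 1) +
                ψ ^ (q + 1) * exp 1 * towerV D τ μk * (Φ * towerV D τ μk) ^ N / (1 - Φ * towerV D τ μk))) :=
            mul_le_mul (mul_le_mul_of_nonneg_left hsq (by positivity)) (mul_le_mul_of_nonneg_right h27 hk0) (by positivity) (by positivity)
        _ = ((27 : ℝ) ^ 5 * (C₁' / C₂')) * Dinc ^ (q + 1) *
              (towerFO D σ μk (q + 1) + ∑ n' ∈ Icc 2 N, exp 1 * Φ ^ (n' - 1) * ψ ^ (q + 1) * towerS D τ μk n' (q + 1) +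
                ψ ^ (q + 1) * exp 1 * towerV D τ μk * (Φ * towerV D τ μk) ^ N / (1 - Φ * towerV D τ μk)) := by ring
        _ ≤ Cinc * Dinc ^ (q + 1) *
              (towerFO D σ μk (q + 1) + ∑ n' ∈ Icc 2 N, exp 1 * Φ ^ (n' - 1) * ψ ^ (q + 1) * towerS D τ μk n' (q + 1) +
                ψ ^ (q + 1) * exp 1 * towerV D τ μk * (Φ * towerV D τ μk) ^ N / (1 - Φ * towerV D τ μk)) :=
            mul_le_mul_of_nonneg_right (mul_le_mul_of_nonneg_right hCinc27 (by positivity)) hk0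
    · have hJ'1 : J' = 1 := by omega
      subst hJ'1
      by_cases hj1 : j = 1
      · -- `j = 1`: the increment vanishes
        have h0 : klEffectiveAction L M β U μ K klE0 j - klTowerInput L M β U μ K 1 1 = 0 := by
          rw [hj1, show (1 : ℕ) = 1 * 1 from rfl]
          unfold klTowerInput
          exact sub_self _
        rw [h0, klLevNormOf_zero, zero_div]
        exact mul_nonneg (by positivity) hk0
      · -- `J′ = 1 < j`: the born bound at `F_1` itself, and `1 ≤ C_inc·D_inc^p`
        have hb := hborn N (by omega) hg t q Ωe hlev
        refine hb.trans ?_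
        exact le_mul_of_one_le_left hk0 hCD1
  -- (4) E1 part 7 with the re-measured part under its own profile and the constant on the increment
  have hfit := towerReadout_le_of_ro_mul (D := D) (μ := μk) hσ hΦ hψ hτ hlam hA'0 hQ'0 hCinc0 hDinc0 hμ0
    himp₁ himp₂ hprof3 hprof hx₁ hx₂ hx₃ hy hθ hp hpub hro hincj
  -- (5) the bracket under one law
  set Yl : ℝ := ι₁ * lam + ι₂ / (2 * Q') + ι₃ / (4 * Q' ^ 2) + A' * Q' / 4 with hYl
  have hYl0 : 0 ≤ Yl := by positivity
  have hTY : 0 ≤ τ * Yl := by positivity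
  have hx10 : 0 ≤ 4 * σ * lam * Q' / (1 - 4 * σ * lam * Q') := div_nonneg (by positivity) (sub_nonneg.2 hx₁.le)
  have hYy : 0 ≤ Φ * (τ * Yl) / (1 - Φ * (τ * Yl)) := div_nonneg (by positivity) (sub_nonneg.2 hy.le)
  have hbr := readoutBracket_le_law_mul_sharp hAro0 hQro0 hA'0 hQ'0 hψ hτ hx10 hTY hYy hCinc0.le hDinc1 (by omega : 1 ≤ p)
  refine hfit.trans ?_
  rw [hAtot, hQtot]
  calc lam ^ (p - 1) * (Aro * Qro ^ p + Cinc * Dinc ^ p *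
          (A' * (4 * Q') ^ p * (4 * σ * lam * Q' / (1 - 4 * σ * lam * Q')) +
            exp 1 * ψ * (2 * τ * ψ * Q') ^ (p - 1) * (τ * Yl) * (Φ * (τ * Yl) / (1 - Φ * (τ * Yl)))))
      ≤ lam ^ (p - 1) * ((Aro + Cinc * (A' * (4 * σ * lam * Q' / (1 - 4 * σ * lam * Q')) +
            exp 1 * (τ * Yl) * (Φ * (τ * Yl) / (1 - Φ * (τ * Yl))) / (2 * τ * Q'))) *
          (Dinc * max 1 (max Qro (max (4 * Q') (2 * τ * ψ * Q')))) ^ p) :=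
        mul_le_mul_of_nonneg_left hbr (by positivity)
    _ = (Aro + Cinc * (A' * (4 * σ * lam * Q' / (1 - 4 * σ * lam * Q')) +
            exp 1 * (τ * Yl) * (Φ * (τ * Yl) / (1 - Φ * (τ * Yl))) / (2 * τ * Q'))) *
          lam ^ (p - 1) * (Dinc * max 1 (max Qro (max (4 * Q') (2 * τ * ψ * Q')))) ^ p := by ring

/-! ## §2 The tower's base rows at `(d, d−1)` from the level-`0` datum -/

omit [NeZero M] in
/-- **`N_b := klTowerMeasLev … d 1` is nonnegative and dominates every levelled norm of `𝒱_d` at `F_{d−1}`** (the honest base array; every `d`, `0 ≤ β`). -/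
theorem klTowerMeasLev_one_baseRows {β : ℝ} (hβ : 0 ≤ β) (U μ : ℝ) (K : TrigPolyC4v) (d : ℕ) :
    (∀ (t : Fin 5) (p : ℕ), 0 ≤ klTowerMeasLev L M β U μ K d 1 (2 * p) ((t : ℕ) + 1)) ∧
    (∀ (t : Fin 5) (p : ℕ) (Ωe' : Fin (2 * p) → Option (SectorLeg (sectorCount (d - 1)))), levelCount Ωe' = (t : ℕ) + 1 →
      klLevNormOf L M β μ K (d - 1) (2 * p) (klTowerInput L M β U μ K d 1) Ωe' ≤ klTowerMeasLev L M β U μ K d 1 (2 * p) ((t : ℕ) + 1)) := by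
  refine ⟨fun t p => klTowerMeasLev_nonneg hβ U μ K d 1 _ _, fun t p => ?_⟩
  have key : ∀ Ωe : Fin (2 * p) → Option (SectorLeg (sectorCount (d * 1 - 1))), levelCount Ωe = (t : ℕ) + 1 →
      klLevNormOf L M β μ K (d * 1 - 1) (2 * p) (klTowerInput L M β U μ K d 1) Ωe ≤ klTowerMeasLev L M β U μ K d 1 (2 * p) ((t : ℕ) + 1) :=
    fun Ωe hlev => by rw [← hlev]; exact klLevNormOf_le_klTowerMeasLev β U μ K d 1 (2 * p) Ωe
  rw [Nat.mul_one] at key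
  exact key

omit [NeZero L] [NeZero M] in
/-- **THE TOWER's BASE UNIT LAW AT `(d, d−1)` FROM THE LEVEL-`0` DATUM AND THE BLOCK-`0` STEP — SHARP ENVELOPE** ((α′) «M6's base datum at `d − 1`»): under
the binders of `readoutLevF_le_profile_blockZero_sharp` at `(j, J′) := (d, d−1)` (`2 ≤ d`, `d − 1 ≤ n_β + 1`) and the field cap `card (HubbardFieldIdx L M) ≤ 2D + 1`,
for EVERY track `t` and EVERY `p ≥ 3`: `klTowerMeasLev … d 1 (2p) (t+1) / klLevUnitF … t p (d−1) ≤ A_tot·λ^{p−1}·Q_tot^p` — the `hlawb` row of the floor-keyed law /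
of RO-4‴ with `N_b := klTowerMeasLev … d 1` (`klTowerMeasLev_one_baseRows` gives `hNb0`/`hcar`) and `(A_b′, Q_b) := (A_tot, Q_tot)`.
[cite: BenfattoGiulianiMastropietro2006, §2.8 (2.82)-(2.84), (2.93)-(2.98), Lemma 2.5 (2.98)] -/
theorem baseLawF_blockZero_sharp :
    ∃ Cinc Dinc : ℝ, 1 ≤ Cinc ∧ 1 ≤ Dinc ∧ ∀ R : RenConsts, R.WF2 → ∃ c₃' : ℝ, 0 < c₃' ∧ ∃ U₀' : ℝ, 0 < U₀' ∧
      ∀ (P : SplitConsts) (c : ℝ), P.WF → 0 < c → c ≤ klEngC₃6 P R → c ≤ c₃' →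
      ∀ μ ∈ klWindowC, ∀ U : ℝ, 0 < U → U ≤ klEngU₀9 P R c → U ≤ U₀' → ∀ β : ℝ, klBetaMin ≤ β → β ≤ Real.exp (c / U ^ 2) →
      ∀ K : TrigPolyC4v, FrameOK R U (nScales β) μ K → ∀ (L M : ℕ) [NeZero L] [NeZero M],
      klEngL₃ β U ≤ L → klEngM₃ β U L ≤ M → ∀ d D : ℕ, 2 ≤ d → d - 1 ≤ nScales β + 1 → 3 ≤ D →
      Fintype.card (HubbardFieldIdx L M) ≤ 2 * D + 1 →
      ∀ (lam Ab Qb : ℝ), 0 < lam → 0 ≤ Ab → 0 ≤ Qb →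
      ∀ Nb : Fin 5 → ℕ → ℝ, (∀ t p, 0 ≤ Nb t p) →
        (∀ (t : Fin 5) (p : ℕ) (Ωe' : Fin (2 * p) → Option (SectorLeg (sectorCount 0))), levelCount Ωe' = (t : ℕ) + 1 →
          klLevNormOf L M β μ K 0 (2 * p) (klTowerInput L M β U μ K 1 1) Ωe' ≤ Nb t p) →
        (∀ (t : Fin 5) (p : ℕ), 3 ≤ p → Nb t p / klLevUnitF β M t p 0 ≤ Ab * lam ^ (p - 1) * Qb ^ p) →
      ∀ (W Z σ Φ ψ τ A' Q' ι₁ ι₂ ι₃ : ℝ), 0 < W → 0 < Z → 0 ≤ σ → 0 ≤ Φ → 0 ≤ ψ → 0 < τ → 0 ≤ A' → 0 < Q' →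
      (∀ m, 4 ≤ m → m ≤ D → W * Z ^ m * klTowerMuLevF L M β U μ K 1 1 m ≤ A' * lam ^ (m - 1) * Q' ^ m) →
      W * Z ^ 3 * klTowerMuLevF L M β U μ K 1 1 3 ≤ ι₃ * lam ^ 2 →
      W * Z ^ 1 * klTowerMuLevF L M β U μ K 1 1 1 ≤ ι₁ * lam →
      W * Z ^ 2 * klTowerMuLevF L M β U μ K 1 1 2 ≤ ι₂ * lam →
      4 * σ * lam * Q' < 1 → 2 * lam * τ * Q' ≤ 1 → exp 1 * τ * lam * Q' < 1 →
      Φ * (τ * (ι₁ * lam + ι₂ / (2 * Q') + ι₃ / (4 * Q' ^ 2) + A' * Q' / 4)) < 1 →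
      Φ * (exp 1 * τ * (ι₁ * lam) + (exp 1 * τ) ^ 2 * (ι₂ * lam) + (exp 1 * τ) ^ 3 * (ι₃ * lam ^ 2) +
        A' * (exp 1 * τ * Q') * ((exp 1 * τ * lam * Q') ^ 3 / (1 - exp 1 * τ * lam * Q'))) < 1 →
      (∀ N : ℕ, 1 ≤ N → Φ * towerV D τ (fun m => W * Z ^ m * klTowerMuLevF L M β U μ K 1 1 m) < 1 →
        ∀ (t : Fin 5) (q : ℕ) (Ωe : Fin (2 * q + 1 + 1) → Option (SectorLeg (sectorCount 1))), levelCount Ωe = (t : ℕ) + 1 →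
        klLevNormOf L M β μ K 1 (2 * q + 1 + 1) (klEffectiveAction L M β U μ K klE0 d - klTowerInput L M β U μ K 1 1) Ωe /
            klLevUnitF β M t (q + 1) 1 ≤
          towerFO D σ (fun m => W * Z ^ m * klTowerMuLevF L M β U μ K 1 1 m) (q + 1) +
            ∑ n' ∈ Icc 2 N, exp 1 * Φ ^ (n' - 1) * ψ ^ (q + 1) * towerS D τ (fun m => W * Z ^ m * klTowerMuLevF L M β U μ K 1 1 m) n' (q + 1) +
            ψ ^ (q + 1) * exp 1 * towerV D τ (fun m => W * Z ^ m * klTowerMuLevF L M β U μ K 1 1 m) *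
              (Φ * towerV D τ (fun m => W * Z ^ m * klTowerMuLevF L M β U μ K 1 1 m)) ^ N /
              (1 - Φ * towerV D τ (fun m => W * Z ^ m * klTowerMuLevF L M β U μ K 1 1 m))) →
      ∀ (Aro Qro Qtot Atot : ℝ), Aro = Cinc * Ab → Qro = Dinc * Qb → Qtot = Dinc * max 1 (max Qro (max (4 * Q') (2 * τ * ψ * Q'))) →
        Atot = Aro + Cinc * (A' * (4 * σ * lam * Q' / (1 - 4 * σ * lam * Q')) +
          exp 1 * (τ * (ι₁ * lam + ι₂ / (2 * Q') + ι₃ / (4 * Q' ^ 2) + A' * Q' / 4)) *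
            (Φ * (τ * (ι₁ * lam + ι₂ / (2 * Q') + ι₃ / (4 * Q' ^ 2) + A' * Q' / 4)) /
              (1 - Φ * (τ * (ι₁ * lam + ι₂ / (2 * Q') + ι₃ / (4 * Q' ^ 2) + A' * Q' / 4)))) / (2 * τ * Q')) →
      ∀ (t : Fin 5) (p : ℕ), 3 ≤ p →
        klTowerMeasLev L M β U μ K d 1 (2 * p) ((t : ℕ) + 1) / klLevUnitF β M t p (d - 1) ≤ Atot * lam ^ (p - 1) * Qtot ^ p := by
  obtain ⟨Cinc, Dinc, hCinc, hDinc, h⟩ := readoutLevF_le_profile_blockZero_sharp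
  refine ⟨Cinc, Dinc, hCinc, hDinc, fun R hR2 => ?_⟩
  obtain ⟨c₃, hc₃, U₀, hU₀, h'⟩ := h R hR2
  refine ⟨c₃, hc₃, U₀, hU₀, ?_⟩
  intro P c hP hc hc6 hc₃' μ hμ U hU hU9 hU₀' β hβmin hβc K hK L M _ _ hL3 hM3 d D hd hdN hD hcard lam Ab Qb hlam hAb hQb Nb hNb0 hcar hlawb
    W Z σ Φ ψ τ A' Q' ι₁ ι₂ ι₃ hW hZ hσ hΦ hψ hτ hA'0 hQ'0 hprof hprof3 himp₁ himp₂ hx₁ hx₂ hx₃ hy hθ hborn Aro Qro Qtot Atot hAro hQro hQtot hAtot t p hp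
  have hβ : 0 < β := KLRegimeSplit.pos_of_klBetaMin_le hβmin
  have hu : 0 < klLevUnitF β M t p (d - 1) := klLevUnitF_pos hβ t p _
  have hCinc0 : 0 < Cinc := lt_of_lt_of_le one_pos hCinc
  have hDinc0 : 0 < Dinc := lt_of_lt_of_le one_pos hDinc
  -- the right-hand side is nonnegative
  have hμ0 : ∀ m, 0 ≤ W * Z ^ m * klTowerMuLevF L M β U μ K 1 1 m := fun m =>
    mul_nonneg (by positivity) (klTowerMuLevF_nonneg (L := L) (M := M) hβ U μ K 1 1 m)
  have hι₁0 : 0 ≤ ι₁ := by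
    have h1 : 0 ≤ ι₁ * lam := (hμ0 1).trans himp₁
    rw [mul_comm] at h1
    exact nonneg_of_mul_nonneg_right h1 hlam
  have hι₂0 : 0 ≤ ι₂ := by
    have h1 : 0 ≤ ι₂ * lam := (hμ0 2).trans himp₂
    rw [mul_comm] at h1
    exact nonneg_of_mul_nonneg_right h1 hlam
  have hι₃0 : 0 ≤ ι₃ := by
    have h1 : 0 ≤ ι₃ * lam ^ 2 := (hμ0 3).trans hprof3
    rw [mul_comm] at h1
    exact nonneg_of_mul_nonneg_right h1 (by positivity)
  have hAro0 : 0 ≤ Aro := by rw [hAro]; positivity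
  have hQro0 : 0 ≤ Qro := by rw [hQro]; positivity
  have hQtot0 : 0 ≤ Qtot := by rw [hQtot]; exact mul_nonneg hDinc0.le (zero_le_one.trans (le_max_left _ _))
  have hx10 : 0 ≤ 4 * σ * lam * Q' / (1 - 4 * σ * lam * Q') := div_nonneg (by positivity) (sub_nonneg.2 hx₁.le)
  have hYy : 0 ≤ Φ * (τ * (ι₁ * lam + ι₂ / (2 * Q') + ι₃ / (4 * Q' ^ 2) + A' * Q' / 4)) /
      (1 - Φ * (τ * (ι₁ * lam + ι₂ / (2 * Q') + ι₃ / (4 * Q' ^ 2) + A' * Q' / 4))) := div_nonneg (by positivity) (sub_nonneg.2 hy.le)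
  have hAtot0 : 0 ≤ Atot := by rw [hAtot]; positivity
  have hRHS : 0 ≤ Atot * lam ^ (p - 1) * Qtot ^ p := by positivity
  -- every level-`(t+1)` norm of `𝒱_d` at `F_{d−1}` is below `RHS · unit`: the read-out for `p ≤ D`, nilpotency above
  have hall : ∀ Ωe : Fin (2 * p) → Option (SectorLeg (sectorCount (d - 1))), levelCount Ωe = (t : ℕ) + 1 →
      klLevNormOf L M β μ K (d - 1) (2 * p) (klTowerInput L M β U μ K d 1) Ωe ≤ Atot * lam ^ (p - 1) * Qtot ^ p * klLevUnitF β M t p (d - 1) := by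
    have hin : klTowerInput L M β U μ K d 1 = klEffectiveAction L M β U μ K klE0 d := by
      unfold klTowerInput; rw [Nat.mul_one]
    intro Ωe hlev
    rw [hin]
    by_cases hpD : p ≤ D
    · have hro := h' P c hP hc hc6 hc₃' μ hμ U hU hU9 hU₀' β hβmin hβc K hK L M hL3 hM3 d (d - 1) D (by omega) (by omega) hdN hD lam Ab Qb hlam hAb hQb
        Nb hNb0 hcar hlawb W Z σ Φ ψ τ A' Q' ι₁ ι₂ ι₃ hW hZ hσ hΦ hψ hτ hA'0 hQ'0 hprof hprof3 himp₁ himp₂ hx₁ hx₂ hx₃ hy hθ hborn Aro Qro Qtot Atot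
        hAro hQro hQtot hAtot t p hp hpD Ωe hlev
      exact (div_le_iff₀ hu).1 hro
    · have hlt : Fintype.card (HubbardFieldIdx L M) < 2 * p := by omega
      unfold klLevNormOf
      rw [hubbardSectorKernelNorm_eq_zero_of_card_lt hβ.le _ hlt _ _]
      exact mul_nonneg hRHS hu.le
  rw [div_le_iff₀ hu]
  refine klTowerMeasLev_le_of_levelBound β U μ K d 1 (2 * p) ((t : ℕ) + 1) (by positivity) ?_
  rw [Nat.mul_one]
  exact hall

end Summit.HubbardSuperconductivity.HubbardSuperconductivity.Theorems.EngineV8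

end
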